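import Literature.Computability.Complexity.GraphCanonizationProgramFPRefine
import Literature.Computability.Complexity.CodeFPListKit
import Literature.Computability.Complexity.CodeFPTableKit
import HarnessLib

/-!
# The canoniser as a list program is typed polynomial time, II: the refiner

`CodeFP` certificates for the refiner of the canoniser on lists
(`GraphCanonizationProgramRefine.lean`: `CGProg.liftL`, `CGProg.refineL = (ocrStepL …)^[n] ∘ liftL`):

* `codeFP_liftL` — the lifted colouring;
* **`codeFP_refineL`** — `n` rounds as a left fold over a unary budget of `n` units, the round
  (`codeFP_ocrStepL`, `GraphCanonizationProgramFPRefine.lean`) reading the fixed context; the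
  accumulator bound: after one round every colour is a count `≤ n` (`ocrStepL_le`), before it the
  accumulator is the precomputed start, which is part of the fold's input.

## References

* S. Arora, B. Barak, *Computational Complexity: A Modern Approach*, CUP 2009, §1.3 (polynomially
  bounded loops). [AroraBarakCC2009]
-/

namespace Literature.Computability.Complexity

open _root_.Computability CodeFP Polynomial

namespace CGProg

/-! ### Sizes along the rounds -/

/-- A round has `n` items. [folklore] -/
@[simp] theorem length_ocrStepL (n : ℕ) (A : List (List Bool)) (mask : List Bool) (col : List ℕ) : (ocrStepL n A mask col).length = n := by
  simp [ocrStepL]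

/-- Every new colour is a count `≤ n`. [folklore] -/
theorem ocrStepL_le (n : ℕ) (A : List (List Bool)) (mask : List Bool) (col : List ℕ) : ∀ x ∈ ocrStepL n A mask col, x ≤ n := by
  intro x hx
  unfold ocrStepL at hx
  obtain ⟨u, -, rfl⟩ := List.mem_map.1 hx
  exact (List.length_filter_le _ _).trans (List.length_range (n := n)).le

/-- Hence the code of any positive iterate is short: `≤ n (2 n + 2)`. [folklore] -/
theorem length_rawE_iterate_ocrStepL (n : ℕ) (A : List (List Bool)) (mask : List Bool) (c₀ : List ℕ) (j : ℕ) :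
    (rawE natE ((ocrStepL n A mask)^[j + 1] c₀)).length ≤ n * (2 * n + 2) := by
  rw [Function.iterate_succ_apply']
  refine (length_rawE_le_of_forall (B := n) fun x hx => (length_natE_le x).trans (ocrStepL_le n A mask _ x hx)).trans ?_
  rw [length_ocrStepL]

/-! ### Certificates -/

/-- **The lifted colouring is typed polynomial time**: input `(mask, colours)`. [cite: AroraBarakCC2009, §1.3] -/
theorem codeFP_liftL : CodeFP (pairE strE (rawE natE)) (rawE natE) (fun p => liftL p.1 p.2) := by
  let κ : (List Bool × List ℕ) × ℕ → List Bool := pairE (pairE strE (rawE natE)) natE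
  have hm : CodeFP κ strE (fun t => t.1.1) := (fst _ _).fst'
  have hc : CodeFP κ (rawE natE) (fun t => t.1.2) := (fst _ _).snd'
  have hv : CodeFP κ natE (fun t => t.2) := snd _ _
  have hbit : CodeFP κ bitE (fun t => bitAt t.1.1 t.2) := (codeFP_bitAt.comp (hm.pair hv)).congr fun _ => rfl
  have hsucc : CodeFP κ natE (fun t => natAt t.1.2 t.2 + 1) := (natAdd.comp ((codeFP_natAt.comp (hc.pair hv)).pair (const _ 1))).congr fun _ => rfl
  have hitem : CodeFP κ natE (fun t => if bitAt t.1.1 t.2 then natAt t.1.2 t.2 + 1 else 0) := hbit.ite hsucc (const _ 0)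
  have hlen : CodeFP (pairE strE (rawE natE)) unE (fun p => p.1.length) := strLength.comp (fst _ _)
  have hr : CodeFP (pairE strE (rawE natE)) (rawE natE) (fun p => List.range p.1.length) := urange.comp hlen
  exact ((map hitem).comp ((CodeFP.id _).pair hr)).congr fun _ => rfl

/-- **The refiner on lists is typed polynomial time** on the context `((1ⁿ, rows, mask), colours)`. [cite: AroraBarakCC2009, §1.3] -/
theorem codeFP_refineL : CodeFP ctxE (rawE natE) (fun s => refineL s.1.1 s.1.2.1 s.1.2.2 s.2) := by
  -- the start `c₀ = liftL mask col`, kept in the context as its second component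
  have hc0 : CodeFP ctxE (rawE natE) (fun s => liftL s.1.2.2 s.2) := (codeFP_liftL.comp ((fst _ _).snd'.snd'.pair (snd _ _))).congr fun _ => rfl
  have hσ : CodeFP ctxE ctxE (fun s => (s.1, liftL s.1.2.2 s.2)) := (fst _ _).pair hc0
  -- one round on the context `(σ, (unit, acc))`
  have hstep : CodeFP (pairE ctxE (pairE unitE (rawE natE))) (rawE natE) (fun t => ocrStepL t.1.1.1 t.1.1.2.1 t.1.1.2.2 t.2.2) :=
    (codeFP_ocrStepL.comp ((fst _ _).fst'.pair (snd _ _).snd')).congr fun _ => rfl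
  have hfold := foldl (σ := Ctx) (α := Unit) (β := List ℕ) (eσ := ctxE) (eα := unitE) (eβ := rawE natE)
    (step := fun s _ acc => ocrStepL s.1.1 s.1.2.1 s.1.2.2 acc) (init := fun s => s.2) hstep (snd _ _) (X * (2 * X + 2) + X)
    (fun s l₁ l₂ => by
      rw [eval_add, eval_mul, eval_add, eval_mul, eval_X, eval_ofNat]
      set w := pairE ctxE (rawE unitE) (s, l₁ ++ l₂) with hw
      have hn : s.1.1 ≤ w.length := by
        rw [hw]; simp only [ctxE, pairE_apply, length_boolPair, length_unE]; omega
      have hs2 : (rawE natE s.2).length ≤ w.length := by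
        rw [hw]; simp only [ctxE, pairE_apply, length_boolPair]; omega
      rw [foldl_units_eq_iterate' (fun acc => ocrStepL s.1.1 s.1.2.1 s.1.2.2 acc)]
      rcases l₁.length.eq_zero_or_pos with h0 | hpos
      · rw [h0, Function.iterate_zero, id]
        exact hs2.trans (Nat.le_add_left _ _)
      · obtain ⟨j, hj⟩ := Nat.exists_eq_add_of_le hpos
        rw [hj, Nat.add_comm]
        refine (length_rawE_iterate_ocrStepL _ _ _ _ j).trans ?_
        exact (Nat.mul_le_mul hn (by omega)).trans (Nat.le_add_right _ _))
  have hunits : CodeFP ctxE (rawE unitE) (fun s => List.replicate s.1.1 ()) := replicateUnit.comp (fst _ _).fst'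
  refine ((hfold.comp (hσ.pair hunits)).congr fun s => ?_)
  show (List.replicate s.1.1 ()).foldl (fun acc _ => ocrStepL s.1.1 s.1.2.1 s.1.2.2 acc) (liftL s.1.2.2 s.2) = refineL s.1.1 s.1.2.1 s.1.2.2 s.2
  rw [foldl_units_eq_iterate' (fun acc => ocrStepL s.1.1 s.1.2.1 s.1.2.2 acc), List.length_replicate]
  rfl

end CGProg

end Literature.Computability.Complexity
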